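import Literature.MathematicalPhysics.QuantumFieldTheory.Balaban1983to89.Node00.OpsYBlockPinOfRecord
import Literature.MathematicalPhysics.QuantumFieldTheory.Balaban1983to89.Node00.OpsYRead342
import Literature.MathematicalPhysics.QuantumFieldTheory.Balaban1983to89.B9CoReadingCoordsS
import Literature.MathematicalPhysics.QuantumFieldTheory.Balaban1983to89.B9Thm37Whole

/-!
# `Balaban1983to89.B9Local342OfBlocksXSK` — T. Bałaban, *Propagators for lattice gauge theories in a background field*, Commun. Math. Phys. **99** (1985) 389–434
# [Balaban1985BackgroundPropagators], (3.42) p. 397 («for x ∈ Δ(y), y ∈ Λ_j, supp λ ⊂ Δ(y′) … y, y′ ∈ 𝔅») + Cor. 3.6 p. 408 ∕ p. 409: THE BLOCK-KEYED (3.42) BRIDGE ON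
# THE SITE COORDINATE CARRIER — block majorants of the `b`-conjugated letters over the ALL-BLOCKS geometry `geoBK i` (blocks keyed BY THEMSELVES, every member, NO
# section of `β`) give the four `Local342`-entry majorants of n06-k's coordinate models `GcoS ∕ DcoS ∘ GcoS ∕ GcoS ∘ DscoS ∕ LcoS ∘ GcoS` keyed by node00-def-Y's block
# pin `blkOfSK`; the block-keyed twin of `B9Local342OfEBlockInv`

statement-level skeleton of published theorems with citation tags; proofs where landed; nothing here is a claim about the Yang–Mills mass gap

**Sources.** B9 = [Balaban1985BackgroundPropagators] T. Bałaban, CMP **99** (1985) 389–434, Thm 3.1 (3.42) p. 397, Cor. 3.6 p. 408, (3.87) p. 409; [4] =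
[Balaban1984PropagatorsII] T. Bałaban, CMP **96** (1984) 223–250, (2.51)–(2.52) p. 232, (2.45)–(2.46) p. 231.

**The print.** (3.42) p. 397: *"|(G′(U)λ)(x)|, |(∇_UG′(U)λ)(x)|, |(G′(U)∇*_Uλ)(x)|, |(Δ_UG′(U)λ)(x)| ≦ B₀[(Lʲη)², Lʲη, Lʲη, 1]e^{−δ₀d(y,y′)}|λ| for x ∈ Δ(y),
y ∈ Λ_j, supp λ ⊂ Δ(y′)"* with *"y, y′ ∈ 𝔅"* — print keys BOTH blocks by the blocks `𝔅` themselves.  p. 409: *"The operators … G′_□(U), … satisfy all the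
inequalities of Theorems 3.1–3.3"*.

**Why this file (pub-ymgap, node N06 [B9], rows 18 ∕ 19; LOCATED-28 and its NODE 00 letter).**  The first bridge `B9Local342OfEBlockInv` reads the (3.42) table in the
`EBlock (kernelFamilySInv …)` currency, whose evaluation and support blocks range over `range β` only (index bonds) — an SC-members currency (LOCATED-28: at a
cornered member an orphan block is never read).  Print's `𝔅`-keyed statement has no such restriction, and the tree holds its currency: block majorants over the
all-blocks geometry `B9SectBAllBlocksGeometryY.geoBK i` (sites = `𝔅`), keyed on r06's carrier `SiteY i × κ` by `(z, j) ↦ Δ(z)` — the hypotheses h0–h3 of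
`B9SectBAllBlocksWriteY.eBlock_kernelFamilyS_of_hasMajorant_blocks` (PLAN (γ′)), which r05's cube road produces BEFORE any section is applied.  node00-def-Y's
`Node00.OpsYBlockPinOfRecord.blkOfSK κ i : XSK κ i → (geoBK i).Site` is the same key on n06-k's coordinate carrier.  This file carries the table across the two
carriers, at the same geometry and key:
* §1 the carrier dictionary `coordOpK b T F (z, ν, a, c) = conj b (T ν) (slice_{ν,c} F) (z, a)` and the slicing of a `blkOfSK`-block-supported vector;
* §2 ★★ `hasMajorant_GcoS_of_blocks`, ★★ `hasMajorantHom_DcoS_GcoS_of_blocks`, ★★ `hasMajorantHom_GcoS_DscoS_of_blocks`, ★★ `hasMajorantHom_LcoS_GcoS_of_blocks` —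
  the four entries with constant `c_R·B_c` and the SAME rate, ALL members, no `β`, no section;
* §3 ★★ `local342_of_blocks_pins` — `B9Thm37Whole.Local342 𝔬` for ANY record `𝔬 : Ops (geoBK i) B (XSK κ i) (XSK κ i) ι` pinned to `blkOfSK` and the models.

HONEST SCOPE.  Carrier ∕ key dictionary algebra; the block tables h0–h3 are HYPOTHESES; nothing of [B9] Cor. 3.6 asserted; count-neutral; rows 18 ∕ 19 NOT thereby
derived; N06 NOT discharged; nothing continuum ∕ OS ∕ mass gap ∕ Clay.  Cell `pub-ymgap` (D-0062), seat `pub-ymgap-dag-n06-c` (gen 22).  Net new unproved facts: 0.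
NEW file.
-/

noncomputable section

namespace Literature.MathematicalPhysics.QuantumFieldTheory.Balaban1983to89.B9Local342OfBlocksXSK

open Node00 (SiteY CfgY SiteOpY UboxY shiftY etaS cdS cdsS lapS)
open B6Geom246MultiLevelBox (blkOf)
open B6KLevelCensusIndexV1 (KIdx)
open B6RandomWalk (HasMajorant BlockSupp)
open B6RandomWalkHom (HasMajorantHom)
open B9Thm34Ext (toB6)
open B9SectBAllBlocksGeometryY (geoBK)
open B9Eq352DivFormLetters (conj conj_apply coordEquiv coordEquiv_symm_apply)
open B9Eq352GradLetters (diffLetter diffLetter_inl diffLetter_inr)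
open B9Ineq349SiteComposite (cdSL cdsSL cdSL_apply cdsSL_apply etaS_pos)
open B9Thm39ReadingCoords (cR39 cR39_nonneg)
open B9CoReadingCoords (assembleK coordOpK coordOpK_apply)
open B9CoReadingCoordsS (XSK GcoS DcoS DscoS LcoS DcoS_comp_GcoS GcoS_comp_DscoS LcoS_comp_GcoS lapSₗ lapSₗ_apply)
open Node00.OpsYRead342 (gradF_mul_apply mul_neg_gradB_apply lap_mul_apply)
open Node00.OpsYBlockPinOfRecord (blkOfSK)
open B9Thm37Whole (Ops Local342)

variable {d ℓ : ℕ} {hd : 1 ≤ d + 1} {hL : Odd (ℓ + 1) ∧ 1 < ℓ + 1} {b₀ b₁ : ℝ}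
variable {𝔸 : Type} [NormedRing 𝔸] [NormedAlgebra ℂ 𝔸] [CompleteSpace 𝔸] [FiniteDimensional ℝ 𝔸]
variable {κ : Type} [Fintype κ]
variable (i : KIdx d ℓ hd hL b₀ b₁) [Fintype (geoBK i).Site] (b : Module.Basis κ ℝ 𝔸)
variable (B : B9.Backgrounds) (cfg : B.Cfg → CfgY 𝔸 i) (O : SiteOpY 𝔸 i)
variable {R₀ : ℝ} {H₀ : Prop} {U₁ : B.Cfg}

/-! ## §1 The carrier dictionary: n06-k's `coordOpK` at a slot is r06's `conj` on the slice -/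

omit [CompleteSpace 𝔸] [FiniteDimensional ℝ 𝔸] [Fintype (geoBK i).Site] in
/-- ★ **THE CARRIER DICTIONARY**: at the slot `(ν, c)` the κ-fold coordinate model reads r06's conjugate on the slice — `(coordOpK b T F)(z, ν, a, c) =
(conj b (T ν) (λ (w, j), F (w, ν, j, c)))(z, a)` (both are `repr_a` of `T ν` applied to `Σ_j F(·, ν, j, c)·b_j`).
[cite: Balaban1984PropagatorsII, (2.51) p.232; Balaban1985BackgroundPropagators, (3.42) p.397, dictionary] -/
theorem coordOpK_apply_eq_conj (T : Fin (d + 1) → (SiteY i → 𝔸) →ₗ[ℝ] (SiteY i → 𝔸)) (F : XSK κ i → ℝ) (z : SiteY i) (ν : Fin (d + 1)) (a c : κ) :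
    coordOpK b T F (z, ν, a, c) = conj b (T ν) (fun p : SiteY i × κ => F (p.1, ν, p.2, c)) (z, a) := by
  have hΛ : (coordEquiv b).symm (fun p : SiteY i × κ => F (p.1, ν, p.2, c)) = assembleK b ν c F := by
    funext w
    rw [coordEquiv_symm_apply]
    rfl
  rw [coordOpK_apply, conj_apply, hΛ]

omit [NormedAlgebra ℂ 𝔸] [CompleteSpace 𝔸] [FiniteDimensional ℝ 𝔸] [Fintype κ] in
/-- **slicing a block-supported coordinate vector**: if `F` on the carrier `XSK` is supported over `{q : Δ(q.1) = y′}` with `|F| ≤ Bd` there (`blkOfSK`-key), every slice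
`(w, j) ↦ F (w, ν, j, c)` is supported over `{(w, j) : Δ(w) = y′}` with the same bound. [cite: Balaban1984PropagatorsII, (2.51) p.232 («supp λ ⊂ B^{j′}(y′)»), bookkeeping] -/
theorem blockSupp_sliceK {y' : (geoBK i).Site} {F : XSK κ i → ℝ} {Bd : ℝ} (hF : BlockSupp (g := toB6 (geoBK i) R₀ H₀) (blkOfSK κ i) F y' Bd)
    (ν : Fin (d + 1)) (c : κ) :
    BlockSupp (g := toB6 (geoBK i) R₀ H₀) (fun p : SiteY i × κ => blkOf i.D.toDomains p.1) (fun p : SiteY i × κ => F (p.1, ν, p.2, c)) y' Bd :=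
  ⟨hF.nonneg, fun p hp => hF.bound (p.1, ν, p.2, c) hp, fun p hp => hF.off (p.1, ν, p.2, c) hp⟩

/-! ## §2 The four block-keyed entries -/

/-- ★★ **ENTRY (3.42)₁, BLOCK-KEYED** — *"|(G′(U)λ)(x)| ≦ B₀(Lʲη)²e^{−δ₀d(y,y′)}|λ|, x ∈ Δ(y), supp λ ⊂ Δ(y′), y, y′ ∈ 𝔅"*: a block majorant `K` of `conj b G`, `G = η²O(U)`,
over the all-blocks geometry keyed by `(z, j) ↦ Δ(z)` gives the block majorant `c_R·K` of the model letter `GcoS … O U` keyed by `blkOfSK` — every member, no section.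
[cite: Balaban1985BackgroundPropagators, (3.42) p.397, Cor. 3.6 p.408 + p.409; Balaban1984PropagatorsII, (2.51) p.232] -/
theorem hasMajorant_GcoS_of_blocks {η : ℝ} (hη : η = etaS i) (G : Module.End ℝ (SiteY i → 𝔸)) (hG : ∀ Λ, G Λ = (η ^ 2) • O (cfg U₁) Λ)
    {K : (geoBK i).Site → (geoBK i).Site → ℝ}
    (h0 : HasMajorant (g := toB6 (geoBK i) R₀ H₀) (fun p : SiteY i × κ => blkOf i.D.toDomains p.1) (conj b G) K) :
    HasMajorant (g := toB6 (geoBK i) R₀ H₀) (blkOfSK κ i) (GcoS i b B cfg O U₁) (fun s s' => cR39 b * K s s') := by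
  subst hη
  intro y' F Bd hF q
  obtain ⟨z, ν, a, c⟩ := q
  have hpt := h0 y' _ Bd (blockSupp_sliceK i (R₀ := R₀) (H₀ := H₀) hF ν c) (z, a)
  have hval : GcoS i b B cfg O U₁ F (z, ν, a, c) = cR39 b * conj b G (fun p : SiteY i × κ => F (p.1, ν, p.2, c)) (z, a) := by
    have hΛ : (coordEquiv b).symm (fun p : SiteY i × κ => F (p.1, ν, p.2, c)) = assembleK b ν c F := by
      funext w; rw [coordEquiv_symm_apply]; rfl
    rw [GcoS, LinearMap.smul_apply, Pi.smul_apply, smul_eq_mul, coordOpK_apply_eq_conj, conj_apply, conj_apply, hΛ, hG, Pi.smul_apply,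
      map_smul, Finsupp.smul_apply, smul_eq_mul, LinearMap.coe_restrictScalars]
    ring
  show |GcoS i b B cfg O U₁ F (z, ν, a, c)| ≤ cR39 b * K (blkOf i.D.toDomains z) y' * Bd
  rw [hval, abs_mul, abs_of_nonneg (cR39_nonneg b), mul_assoc]
  exact mul_le_mul_of_nonneg_left hpt (cR39_nonneg b)

/-- ★★ **ENTRY (3.42)₂, BLOCK-KEYED** — *"|(∇_UG′(U)λ)(x)| ≦ B₀(Lʲη)e^{−δ₀d(y,y′)}|λ|"*: block majorants `K` of `conj b (η⁻¹∇_μ-letter) * conj b G` for every `μ` give the block majorant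
`c_R·K` of `DcoS ∘ GcoS` keyed by `blkOfSK`. [cite: Balaban1985BackgroundPropagators, (3.42) p.397, (3.3) p.390, Cor. 3.6 p.408; Balaban1984PropagatorsII, (2.51) p.232] -/
theorem hasMajorantHom_DcoS_GcoS_of_blocks {η : ℝ} (hη : η = etaS i) {Uc : Fin (d + 1) → SiteY i → 𝔸ˣ} (hUc : Uc = UboxY i (cfg U₁))
    (G : Module.End ℝ (SiteY i → 𝔸)) (hG : ∀ Λ, G Λ = (η ^ 2) • O (cfg U₁) Λ) {K : (geoBK i).Site → (geoBK i).Site → ℝ}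
    (h1 : ∀ μ : Fin (d + 1), HasMajorant (g := toB6 (geoBK i) R₀ H₀) (fun p : SiteY i × κ => blkOf i.D.toDomains p.1)
      (conj b (diffLetter (shiftY i) Uc (((η : ℂ))⁻¹) (Sum.inl μ)) * conj b G) K) :
    HasMajorantHom (g := toB6 (geoBK i) R₀ H₀) (blkOfSK κ i) (blkOfSK κ i) (DcoS i b B cfg U₁ ∘ₗ GcoS i b B cfg O U₁) (fun s s' => cR39 b * K s s') := by
  subst hη hUc
  intro y' F Bd hF q
  obtain ⟨z, ν, a, c⟩ := q
  have h1' := h1 ν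
  rw [diffLetter_inl, ← B9Eq352DivFormLetters.conj_mul] at h1'
  have hpt := h1' y' _ Bd (blockSupp_sliceK i (R₀ := R₀) (H₀ := H₀) hF ν c) (z, a)
  have hval : (DcoS i b B cfg U₁ ∘ₗ GcoS i b B cfg O U₁) F (z, ν, a, c) =
      cR39 b * conj b (B9Eq352DivFormLetters.gradLetterF (shiftY i) (UboxY i (cfg U₁)) ((((etaS i : ℝ) : ℂ))⁻¹) ν * G)
        (fun p : SiteY i × κ => F (p.1, ν, p.2, c)) (z, a) := by
    rw [DcoS_comp_GcoS, LinearMap.smul_apply, Pi.smul_apply, smul_eq_mul, coordOpK_apply_eq_conj, conj_apply, conj_apply]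
    have hΛ : (coordEquiv b).symm (fun p : SiteY i × κ => F (p.1, ν, p.2, c)) = assembleK b ν c F := by
      funext w; rw [coordEquiv_symm_apply]; rfl
    rw [hΛ, gradF_mul_apply i O (cfg U₁) G hG ν (assembleK b ν c F) z, Complex.coe_smul, map_smul, Finsupp.smul_apply, smul_eq_mul, LinearMap.comp_apply,
      LinearMap.coe_restrictScalars, LinearMap.coe_restrictScalars, cdSL_apply]
    ring
  show |(DcoS i b B cfg U₁ ∘ₗ GcoS i b B cfg O U₁) F (z, ν, a, c)| ≤ cR39 b * K (blkOf i.D.toDomains z) y' * Bd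
  rw [hval, abs_mul, abs_of_nonneg (cR39_nonneg b), mul_assoc]
  exact mul_le_mul_of_nonneg_left hpt (cR39_nonneg b)

/-- ★★ **ENTRY (3.42)₃, BLOCK-KEYED** — *"|(G′(U)∇*_Uλ)(x)| ≦ B₀(Lʲη)e^{−δ₀d(y,y′)}|λ|"*: block majorants `K` of `conj b G * conj b (−η⁻¹∇*_μ-letter)` for every `μ` give the block
majorant `c_R·K` of `GcoS ∘ DscoS` keyed by `blkOfSK`. [cite: Balaban1985BackgroundPropagators, (3.42) p.397, (3.8) p.392, Cor. 3.6 p.408; Balaban1984PropagatorsII, (2.51) p.232] -/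
theorem hasMajorantHom_GcoS_DscoS_of_blocks {η : ℝ} (hη : η = etaS i) {Uc : Fin (d + 1) → SiteY i → 𝔸ˣ} (hUc : Uc = UboxY i (cfg U₁))
    (G : Module.End ℝ (SiteY i → 𝔸)) (hG : ∀ Λ, G Λ = (η ^ 2) • O (cfg U₁) Λ) {K : (geoBK i).Site → (geoBK i).Site → ℝ}
    (h2 : ∀ μ : Fin (d + 1), HasMajorant (g := toB6 (geoBK i) R₀ H₀) (fun p : SiteY i × κ => blkOf i.D.toDomains p.1)
      (conj b G * conj b (diffLetter (shiftY i) Uc (((η : ℂ))⁻¹) (Sum.inr μ))) K) :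
    HasMajorantHom (g := toB6 (geoBK i) R₀ H₀) (blkOfSK κ i) (blkOfSK κ i) (GcoS i b B cfg O U₁ ∘ₗ DscoS i b B cfg U₁) (fun s s' => cR39 b * K s s') := by
  subst hη hUc
  intro y' F Bd hF q
  obtain ⟨z, ν, a, c⟩ := q
  have h2' := h2 ν
  rw [diffLetter_inr, ← B9Eq352DivFormLetters.conj_mul] at h2'
  have hpt := h2' y' _ Bd (blockSupp_sliceK i (R₀ := R₀) (H₀ := H₀) hF ν c) (z, a)
  have hval : (GcoS i b B cfg O U₁ ∘ₗ DscoS i b B cfg U₁) F (z, ν, a, c) =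
      -(cR39 b * conj b (G * -B9Eq352DivFormLetters.gradLetterB (shiftY i) (UboxY i (cfg U₁)) ((((etaS i : ℝ) : ℂ))⁻¹) ν)
        (fun p : SiteY i × κ => F (p.1, ν, p.2, c)) (z, a)) := by
    rw [GcoS_comp_DscoS, LinearMap.smul_apply, Pi.smul_apply, smul_eq_mul, coordOpK_apply_eq_conj, conj_apply, conj_apply]
    have hΛ : (coordEquiv b).symm (fun p : SiteY i × κ => F (p.1, ν, p.2, c)) = assembleK b ν c F := by
      funext w; rw [coordEquiv_symm_apply]; rfl
    rw [hΛ, mul_neg_gradB_apply i O (cfg U₁) G hG ν (assembleK b ν c F) z, Complex.coe_smul, map_neg, map_smul, Finsupp.neg_apply, Finsupp.smul_apply,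
      smul_eq_mul, LinearMap.comp_apply, LinearMap.coe_restrictScalars, LinearMap.coe_restrictScalars, cdsSL_apply]
    ring
  show |(GcoS i b B cfg O U₁ ∘ₗ DscoS i b B cfg U₁) F (z, ν, a, c)| ≤ cR39 b * K (blkOf i.D.toDomains z) y' * Bd
  rw [hval, abs_neg, abs_mul, abs_of_nonneg (cR39_nonneg b), mul_assoc]
  exact mul_le_mul_of_nonneg_left hpt (cR39_nonneg b)

/-- ★★ **ENTRY (3.42)₄, BLOCK-KEYED** — *"|(Δ_UG′(U)λ)(x)| ≦ B₀e^{−δ₀d(y,y′)}|λ|"*: a block majorant `K` of `conj b L * conj b G`, `L = η⁻²Δ_U`, gives the block majorant `c_R·K` of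
`LcoS ∘ GcoS` keyed by `blkOfSK`. [cite: Balaban1985BackgroundPropagators, (3.42) p.397, (3.23) p.394, Cor. 3.6 p.408; Balaban1984PropagatorsII, (2.51) p.232] -/
theorem hasMajorantHom_LcoS_GcoS_of_blocks {η : ℝ} (hη : η = etaS i) (G L : Module.End ℝ (SiteY i → 𝔸)) (hG : ∀ Λ, G Λ = (η ^ 2) • O (cfg U₁) Λ)
    (hL : ∀ Λ, L Λ = (η ^ 2)⁻¹ • lapS i (cfg U₁) Λ) {K : (geoBK i).Site → (geoBK i).Site → ℝ}
    (h3 : HasMajorant (g := toB6 (geoBK i) R₀ H₀) (fun p : SiteY i × κ => blkOf i.D.toDomains p.1) (conj b L * conj b G) K) :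
    HasMajorantHom (g := toB6 (geoBK i) R₀ H₀) (blkOfSK κ i) (blkOfSK κ i) (LcoS i b B cfg U₁ ∘ₗ GcoS i b B cfg O U₁) (fun s s' => cR39 b * K s s') := by
  subst hη
  intro y' F Bd hF q
  obtain ⟨z, ν, a, c⟩ := q
  rw [← B9Eq352DivFormLetters.conj_mul] at h3
  have hpt := h3 y' _ Bd (blockSupp_sliceK i (R₀ := R₀) (H₀ := H₀) hF ν c) (z, a)
  have hval : (LcoS i b B cfg U₁ ∘ₗ GcoS i b B cfg O U₁) F (z, ν, a, c) = cR39 b * conj b (L * G) (fun p : SiteY i × κ => F (p.1, ν, p.2, c)) (z, a) := by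
    rw [LcoS_comp_GcoS, LinearMap.smul_apply, Pi.smul_apply, smul_eq_mul, coordOpK_apply_eq_conj, conj_apply, conj_apply]
    have hΛ : (coordEquiv b).symm (fun p : SiteY i × κ => F (p.1, ν, p.2, c)) = assembleK b ν c F := by
      funext w; rw [coordEquiv_symm_apply]; rfl
    rw [hΛ, lap_mul_apply i O (cfg U₁) G L hG hL (assembleK b ν c F) z, LinearMap.comp_apply, LinearMap.coe_restrictScalars, lapSₗ_apply]
  show |(LcoS i b B cfg U₁ ∘ₗ GcoS i b B cfg O U₁) F (z, ν, a, c)| ≤ cR39 b * K (blkOf i.D.toDomains z) y' * Bd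
  rw [hval, abs_mul, abs_of_nonneg (cR39_nonneg b), mul_assoc]
  exact mul_le_mul_of_nonneg_left hpt (cR39_nonneg b)

/-! ## §3 `Local342` of a block-keyed record from the per-cube block tables -/

section Transport

variable {G : B6.Geometry} {X Y : Type}

/-- a block majorant transported along equalities of the block map and of the operator. [folklore] -/
private theorem hasMajorant_of_pins {blk blk' : X → G.Site} {T T' : Module.End ℝ (X → ℝ)} {K : G.Site → G.Site → ℝ} (hb : blk = blk') (hT : T = T')
    (h : HasMajorant (g := G) blk' T' K) : HasMajorant (g := G) blk T K := by
  subst hb hT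
  exact h

/-- a two-block majorant transported along equalities of the block maps and of the operator. [folklore] -/
private theorem hasMajorantHom_of_pins {blkX blkX' : X → G.Site} {blkY blkY' : Y → G.Site} {T T' : (X → ℝ) →ₗ[ℝ] (Y → ℝ)} {K : G.Site → G.Site → ℝ}
    (hX : blkX = blkX') (hY : blkY = blkY') (hT : T = T') (h : HasMajorantHom (g := G) blkX' blkY' T' K) : HasMajorantHom (g := G) blkX blkY T K := by
  subst hX hY hT
  exact h

end Transport

/-- ★★ **`Local342` AT THE BLOCK-KEYED PINS** — p. 409 «the operators G′_□(U) … satisfy all the inequalities of Theorems 3.1–3.3», every member, no section: for a letter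
record `𝔬 : Ops (geoBK i) …` over the site coordinate carrier whose blocks are node00-def-Y's `blkOfSK` and whose fields `Gsq U □ ∕ D U ∕ Dstar U ∕ Lap U` are the models
`GcoS … (O □) U ∕ DcoS ∕ DscoS ∕ LcoS`, the per-cube block tables h0–h3 (PLAN (γ′) shapes, one pair `(B_c, δ)`) give `Local342 𝔬 R H (c_R·B_c) δ U`.
[cite: Balaban1985BackgroundPropagators, Cor. 3.6 p.408 + p.409, (3.42) p.397, (3.87) p.409; Balaban1984PropagatorsII, (2.51) p.232] -/
theorem local342_of_blocks_pins {ι : Type} (Oc : ι → SiteOpY 𝔸 i) (𝔬 : Ops (geoBK i) B (XSK κ i) (XSK κ i) ι)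
    (hblk : 𝔬.blk = blkOfSK κ i) (hblkY : 𝔬.blkY = blkOfSK κ i) (hGsq : ∀ j, 𝔬.Gsq U₁ j = GcoS i b B cfg (Oc j) U₁)
    (hD : 𝔬.D U₁ = DcoS i b B cfg U₁) (hDs : 𝔬.Dstar U₁ = DscoS i b B cfg U₁) (hLap : 𝔬.Lap U₁ = LcoS i b B cfg U₁)
    {η : ℝ} (hη : η = etaS i) {Uc : Fin (d + 1) → SiteY i → 𝔸ˣ} (hUc : Uc = UboxY i (cfg U₁))
    (G : ι → Module.End ℝ (SiteY i → 𝔸)) (L : Module.End ℝ (SiteY i → 𝔸)) (hG : ∀ j Λ, G j Λ = (η ^ 2) • Oc j (cfg U₁) Λ)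
    (hL : ∀ Λ, L Λ = (η ^ 2)⁻¹ • lapS i (cfg U₁) Λ) {Bc δ : ℝ}
    (h0 : ∀ j, HasMajorant (g := toB6 (geoBK i) R₀ H₀) (fun p : SiteY i × κ => blkOf i.D.toDomains p.1) (conj b (G j))
      (fun s s' => Bc * (geoBK i).len s ^ 2 * Real.exp (-(δ * (geoBK i).dist s s'))))
    (h1 : ∀ j (μ : Fin (d + 1)), HasMajorant (g := toB6 (geoBK i) R₀ H₀) (fun p : SiteY i × κ => blkOf i.D.toDomains p.1)
      (conj b (diffLetter (shiftY i) Uc (((η : ℂ))⁻¹) (Sum.inl μ)) * conj b (G j))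
      (fun s s' => Bc * (geoBK i).len s * Real.exp (-(δ * (geoBK i).dist s s'))))
    (h2 : ∀ j (μ : Fin (d + 1)), HasMajorant (g := toB6 (geoBK i) R₀ H₀) (fun p : SiteY i × κ => blkOf i.D.toDomains p.1)
      (conj b (G j) * conj b (diffLetter (shiftY i) Uc (((η : ℂ))⁻¹) (Sum.inr μ)))
      (fun s s' => Bc * (geoBK i).len s * Real.exp (-(δ * (geoBK i).dist s s'))))
    (h3 : ∀ j, HasMajorant (g := toB6 (geoBK i) R₀ H₀) (fun p : SiteY i × κ => blkOf i.D.toDomains p.1) (conj b L * conj b (G j))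
      (fun s s' => Bc * 1 * Real.exp (-(δ * (geoBK i).dist s s')))) :
    Local342 𝔬 R₀ H₀ (cR39 b * Bc) δ U₁ := by
  have e0 : ∀ j, HasMajorant (g := toB6 (geoBK i) R₀ H₀) (blkOfSK κ i) (GcoS i b B cfg (Oc j) U₁)
      (fun s s' => cR39 b * Bc * (geoBK i).len s ^ 2 * Real.exp (-(δ * (geoBK i).dist s s'))) := fun j => by
    have h := hasMajorant_GcoS_of_blocks i b B cfg (Oc j) (R₀ := R₀) (H₀ := H₀) hη (G j) (hG j) (h0 j)
    simpa only [mul_assoc] using h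
  have e1 : ∀ j, HasMajorantHom (g := toB6 (geoBK i) R₀ H₀) (blkOfSK κ i) (blkOfSK κ i) (DcoS i b B cfg U₁ ∘ₗ GcoS i b B cfg (Oc j) U₁)
      (fun s s' => cR39 b * Bc * (geoBK i).len s * Real.exp (-(δ * (geoBK i).dist s s'))) := fun j => by
    have h := hasMajorantHom_DcoS_GcoS_of_blocks i b B cfg (Oc j) (R₀ := R₀) (H₀ := H₀) hη hUc (G j) (hG j) (h1 j)
    simpa only [mul_assoc] using h
  have e2 : ∀ j, HasMajorantHom (g := toB6 (geoBK i) R₀ H₀) (blkOfSK κ i) (blkOfSK κ i) (GcoS i b B cfg (Oc j) U₁ ∘ₗ DscoS i b B cfg U₁)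
      (fun s s' => cR39 b * Bc * (geoBK i).len s * Real.exp (-(δ * (geoBK i).dist s s'))) := fun j => by
    have h := hasMajorantHom_GcoS_DscoS_of_blocks i b B cfg (Oc j) (R₀ := R₀) (H₀ := H₀) hη hUc (G j) (hG j) (h2 j)
    simpa only [mul_assoc] using h
  have e3 : ∀ j, HasMajorantHom (g := toB6 (geoBK i) R₀ H₀) (blkOfSK κ i) (blkOfSK κ i) (LcoS i b B cfg U₁ ∘ₗ GcoS i b B cfg (Oc j) U₁)
      (fun s s' => cR39 b * Bc * Real.exp (-(δ * (geoBK i).dist s s'))) := fun j => by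
    have h := hasMajorantHom_LcoS_GcoS_of_blocks i b B cfg (Oc j) (R₀ := R₀) (H₀ := H₀) hη (G j) L (hG j) hL (h3 j)
    simpa only [mul_one, mul_assoc] using h
  refine ⟨fun j => ?_, fun j => ?_, fun j => ?_, fun j => ?_⟩
  · exact hasMajorant_of_pins hblk (by rw [hGsq]) (e0 j)
  · exact hasMajorantHom_of_pins hblk hblkY (by rw [hD, hGsq]) (e1 j)
  · exact hasMajorantHom_of_pins hblkY hblk (by rw [hDs, hGsq]) (e2 j)
  · exact hasMajorantHom_of_pins hblk hblk (by rw [hLap, hGsq]) (e3 j)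

end Literature.MathematicalPhysics.QuantumFieldTheory.Balaban1983to89.B9Local342OfBlocksXSK
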